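import Literature.Claims.NS.Sarici2026
import Mathlib.MeasureTheory.Integral.IntervalIntegral.FundThmCalculus
import Mathlib.Analysis.Calculus.Deriv.MeanValue
import Mathlib.Analysis.SpecialFunctions.ExpDeriv
import HarnessLib

/-!
# Solo salvage for claim C169 `Sarici2026` (cell `ns-claims`, D-0090): the Grönwall passage (6.5) ⇒ (6.7)
# under the printed-implicit continuity, kernel

Claim skeleton: `Literature/Claims/NS/Sarici2026.lean` (E. Sarici, Zenodo 19312090 v4, 45 pp.; typist
`ns-claims-typist-9` g6, p544680). This file (seat `ns-claims-salvage-p3` g5, SALVAGE pen; records-grade, off the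
verdict) records what the printed sentence «Applying the classical Gronwall's inequality yields (6.7)» (p.6
l.82–83) DOES give at the typed grain:

* `le_mul_exp_integral_of_deriv_le` — Grönwall in derivative form with a VARIABLE coefficient: `X` continuous on
  `[0,T)`, differentiable on `(0,T)` with `X' ≤ g·X`, `g` continuous ⇒ `X(t) ≤ X(0)·exp(∫₀ᵗ g)` (no sign
  hypotheses; `X·e^{−∫g}` is non-increasing);
* `hDotSq_toReal_le_of_step65` — from the typed (6.5) (`Step_65 ν s`: differentiability of
  `τ ↦ ‖u(τ)‖²_{Ḣ^s}` on the OPEN interval with the Kato–Ponce inequality) PLUS the two clauses the print leaves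
  implicit — continuity of `τ ↦ ‖u(τ)‖²_{Ḣ^s}` on `[0,T)` (right-continuity at `0` anchors `‖u₀‖²_{Ḣ^s}`) and of
  `τ ↦ ‖∇u(τ)‖_∞` — the (6.7) bound in real form, `‖u(t)‖²_{Ḣ^s} ≤ ‖u₀‖²_{Ḣ^s}·exp(C∫₀ᵗ‖∇u‖_∞)`.
  The typed binder `Step_67_of ν s` (= `Step_65 → Step_67` WITHOUT those clauses) is not claimed here.

Solo lane (`Theorems/SoloSalvage<Slug>….lean`, no item).

WHAT THIS IS NOT: not a claim about NS regularity or blow-up; not a claim about any author beyond the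
typed locator.
-/

noncomputable section

set_option linter.dupNamespace false

open Set MeasureTheory Filter intervalIntegral
open scoped Topology ENNReal NNReal

namespace Summit.NavierStokesRegularity.NavierStokesRegularity.Theorems.Sarici2026Salvage

open Literature.Claims.NS Literature.Claims.NS.Sarici2026

/-- **Grönwall, derivative form with a variable coefficient**: if `X` is continuous on `[0,T)`, differentiable on
`(0,T)` with `X'(t) ≤ g(t)·X(t)` there, and `g` is continuous on `[0,T)`, then
`X(t) ≤ X(0)·exp(∫₀ᵗ g)` for every `t ∈ [0,T)`. (No sign hypothesis on `X` or `g`: `X·e^{−∫g}` is non-increasing.)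
[folklore] -/
theorem le_mul_exp_integral_of_deriv_le {T : ℝ} {X X' g : ℝ → ℝ}
    (hXc : ContinuousOn X (Ico 0 T)) (hg : ContinuousOn g (Ico 0 T))
    (hX : ∀ t ∈ Ioo 0 T, HasDerivAt X (X' t) t) (hle : ∀ t ∈ Ioo 0 T, X' t ≤ g t * X t) :
    ∀ t ∈ Ico 0 T, X t ≤ X 0 * Real.exp (∫ s in (0:ℝ)..t, g s) := by
  intro t ht
  rcases ht.1.eq_or_lt with h0 | htpos
  · subst h0; simp
  -- work on the closed interval `[0, t] ⊆ [0, T)`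
  have hsub : Icc (0 : ℝ) t ⊆ Ico 0 T := fun s hs => ⟨hs.1, lt_of_le_of_lt hs.2 ht.2⟩
  have hgI : ContinuousOn g (Icc 0 t) := hg.mono hsub
  have hgint : ∀ s ∈ Icc (0 : ℝ) t, IntervalIntegrable g volume 0 s := fun s hs =>
    (hgI.mono (Icc_subset_Icc le_rfl hs.2)).intervalIntegrable_of_Icc hs.1
  set G : ℝ → ℝ := fun s => ∫ r in (0:ℝ)..s, g r with hG
  -- `G` is continuous on `[0,t]` and `G' = g` on `(0,t)`
  have hGc : ContinuousOn G (Icc 0 t) := by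
    have h := continuousOn_primitive_interval' (hgint t ⟨ht.1, le_rfl⟩) (by rw [uIcc_of_le ht.1]; exact ⟨le_rfl, ht.1⟩)
    rw [uIcc_of_le ht.1] at h
    exact h
  have hGd : ∀ s ∈ Ioo (0 : ℝ) t, HasDerivAt G (g s) s := by
    intro s hs
    have hsT : s ∈ Ioo 0 T := ⟨hs.1, hs.2.trans_le ht.2.le⟩
    refine integral_hasDerivAt_right (hgint s ⟨hs.1.le, hs.2.le⟩) ?_ ?_
    · exact (hg.mono Ioo_subset_Ico_self).stronglyMeasurableAtFilter isOpen_Ioo _ hsT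
    · exact (hg.mono Ioo_subset_Ico_self).continuousAt (isOpen_Ioo.mem_nhds hsT)
  -- `F = X · exp(−G)` is non-increasing on `[0,t]`
  set F : ℝ → ℝ := fun s => X s * Real.exp (-G s) with hF
  have hFc : ContinuousOn F (Icc 0 t) :=
    (hXc.mono hsub).mul (hGc.neg.rexp)
  have hFd : ∀ s ∈ Ioo (0 : ℝ) t, HasDerivAt F (X' s * Real.exp (-G s) + X s * (-g s * Real.exp (-G s))) s := by
    intro s hs
    have hsT : s ∈ Ioo 0 T := ⟨hs.1, hs.2.trans_le ht.2.le⟩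
    have h1 := hX s hsT
    have h2 : HasDerivAt (fun r => Real.exp (-G r)) (-g s * Real.exp (-G s)) s := by
      have := ((hGd s hs).neg).exp
      simpa [mul_comm] using this
    exact h1.mul h2
  have hanti : AntitoneOn F (Icc 0 t) := by
    refine antitoneOn_of_deriv_nonpos (convex_Icc 0 t) hFc ?_ ?_
    · intro s hs
      rw [interior_Icc] at hs
      exact (hFd s hs).differentiableAt.differentiableWithinAt
    · intro s hs
      rw [interior_Icc] at hs
      rw [(hFd s hs).deriv]
      have hsT : s ∈ Ioo 0 T := ⟨hs.1, hs.2.trans_le ht.2.le⟩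
      have hpos : 0 < Real.exp (-G s) := Real.exp_pos _
      have := hle s hsT
      nlinarith
  have hF0 : F 0 = X 0 := by simp [hF, hG]
  have hFt : F t ≤ F 0 := hanti ⟨le_rfl, ht.1⟩ ⟨ht.1, le_rfl⟩ ht.1
  rw [hF0] at hFt
  -- unfold `F t ≤ X 0`
  have hexp : 0 < Real.exp (G t) := Real.exp_pos _
  have : X t = F t * Real.exp (G t) := by
    simp only [hF]; rw [mul_assoc, ← Real.exp_add, neg_add_cancel, Real.exp_zero, mul_one]
  rw [this]
  exact mul_le_mul_of_nonneg_right hFt hexp.le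


/-- **The Grönwall passage (6.5) ⇒ (6.7), p.6 l.82–92, under the printed-implicit continuity**: if (6.5) holds
in the typed form `Step_65 ν s` (constant `C`), then along every solution of the class whose `Ḣ^s` energy
`τ ↦ ‖u(τ)‖²_{Ḣ^s}` and gradient sup `τ ↦ ‖∇u(τ)‖_∞` are continuous (as real numbers) on `[0,T)`,
`‖u(t)‖²_{Ḣ^s} ≤ ‖u₀‖²_{Ḣ^s} · exp(C ∫₀ᵗ ‖∇u(τ)‖_∞ dτ)` for every `t ∈ [0,T)` (real form; the dissipation
`2ν‖u‖²_{Ḣ^{s+1}} ≥ 0` is dropped). [cite: Sarici2026, (6.7) p.6 l.82–92 with (6.5) l.60–70] -/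
theorem hDotSq_toReal_le_of_step65 {ν : ℝ} (hν : 0 ≤ ν) {s : ℕ} (h65 : Step_65 ν s) :
    ∃ C : ℝ≥0, ∀ (u₀ : E3 → E3) (T : ℝ) (u : ℝ → E3 → E3) (p : ℝ → E3 → ℝ), IsDatum u₀ →
      IsSol ν T u₀ u p →
      ContinuousOn (fun τ => (hDotSq s (u τ)).toReal) (Ico 0 T) →
      ContinuousOn (fun τ => (gradSup (u τ)).toReal) (Ico 0 T) →
      ∀ t ∈ Ico 0 T, (hDotSq s (u t)).toReal ≤
        (hDotSq s u₀).toReal * Real.exp (C * ∫ τ in (0:ℝ)..t, (gradSup (u τ)).toReal) := by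
  obtain ⟨C, hC⟩ := h65
  refine ⟨C, fun u₀ T u p hd hS hX hg t ht => ?_⟩
  have hu0 : u 0 = u₀ := hS.2.1
  -- the differential inequality of (6.5), dissipation `2ν‖u‖²_{Ḣ^{s+1}} ≥ 0` dropped
  have hX' : ∀ τ ∈ Ioo 0 T, HasDerivAt (fun τ => (hDotSq s (u τ)).toReal)
      (deriv (fun τ => (hDotSq s (u τ)).toReal) τ) τ := fun τ hτ => (hC u₀ T u p hd hS τ hτ).1.hasDerivAt
  have hle : ∀ τ ∈ Ioo 0 T, deriv (fun τ => (hDotSq s (u τ)).toReal) τ ≤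
      (C * (gradSup (u τ)).toReal) * (hDotSq s (u τ)).toReal := by
    intro τ hτ
    have h := (hC u₀ T u p hd hS τ hτ).2
    have hdiss : 0 ≤ 2 * ν * (hDotSq (s + 1) (u τ)).toReal := by positivity
    linarith
  have hgC : ContinuousOn (fun τ => (C : ℝ) * (gradSup (u τ)).toReal) (Ico 0 T) :=
    continuousOn_const.mul hg
  have key := le_mul_exp_integral_of_deriv_le hX hgC hX' hle t ht
  rw [intervalIntegral.integral_const_mul] at key
  simpa only [hu0] using key

end Summit.NavierStokesRegularity.NavierStokesRegularity.Theorems.Sarici2026Salvage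

end
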